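import Summits.ResolutionOfSingularities.ResolutionOfSingularities.Theorems.SharpStrataSepExcModelsRatAbhyankarModel
import Literature.AlgebraicGeometry.Resolution.FiniteBirationalNormal
import Mathlib.AlgebraicGeometry.FunctionField
import Mathlib.RingTheory.RegularLocalRing.Defs
import HarnessLib

/-!
# Descent of separable exceptionality, I: transport of local models and the function field
# isomorphism of a birational morphism

Line `birth` of crux `SharpStrata.SepExcModels` (stmt-ResolutionOfSingularities-16828,
`Cruxes/SepExcModels/Lines/birth.lean`), lead c1, tool stub (T4s, scheme form of descent)
`stub_sepExcAt_descends`: helper file (part I of II).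

The third disjunct of `SepExcAt Y ζ` ("`ζ` carries a separable regular birational local
model") is, in ring form over a local ring `R` inside a field `K`: some `B = R[s] ⊆ K` (`s`
finite) has a prime `𝔮` over `𝔪_R` with `B_𝔮` regular and `(B/𝔮)[1/g]` smooth over
`κ(R) = R/𝔪_R` for some `g ∉ 𝔮`. This file provides the three model-independent bricks of the
scheme form of descent (`…SepExcDescends.lean`):

* `model_of_algEquiv` — the ring form is invariant under `R`-algebra isomorphisms of the ambient
  field `K' ≃ₐ[R] K` (push `s`, `𝔮`, `g` forward; `B_𝔮`, `B/𝔮`, `(B/𝔮)[1/g]` are replaced by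
  isomorphic rings);
* `model_of_isRegularLocalRing` — a regular local `R ⊆ K` carries the trivial model `s = ∅`,
  `B = R`, `𝔮 = 𝔪_R`, `g = 1` (`(B/𝔮)[1/1] = κ(R)`);
* `exists_ringEquiv_functionField_of_isBirational` — a birational morphism `π : Y' → Y` of
  integral schemes identifies the function fields, `K(Y) ≃ K(Y')`, compatibly with every stalk
  map `𝒪_{Y,π y} → 𝒪_{Y',y}` (the stalk map at the generic point is an isomorphism,
  `IsBirational.isIso_stalkMap_genericPoint`, and stalk maps commute with specialisation).

## Sources

* A. Benito, O. Piltant, A. J. Reguera, *Small irreducible components of arc spaces in positive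
  characteristic*, J. Pure Appl. Algebra 226 (2022) 107113, Lemma 4.2, Prop. 4.3.
  [BenitoPiltantReguera2022]
* The Stacks Project, Tag 01RN (birational morphisms), Tag 0BXD. [StacksProject]
-/

noncomputable section

-- single-problem summit: the doubled namespace component `ResolutionOfSingularities` is forced
set_option linter.dupNamespace false

open CategoryTheory AlgebraicGeometry TopologicalSpace
open Literature.AlgebraicGeometry.Resolution IsLocalRing
open Summit.ResolutionOfSingularities.ResolutionOfSingularities.Theorems.SepExcModels.RatAbhyankarModel

namespace Summit.ResolutionOfSingularities.ResolutionOfSingularities.Theorems.SepExcModels.SepExcDescends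

universe u

/-! ## Transport of smoothness along a ring isomorphism -/

/-- Smoothness of an algebra given by an explicit structure map `A → X` transports along a ring
isomorphism `X ≃ Y` compatible with the structure maps. [folklore] -/
theorem smooth_of_ringEquiv_comp {A X Y : Type*} [CommRing A] [CommRing X] [CommRing Y]
    (fX : A →+* X) (fY : A →+* Y) (Θ : X ≃+* Y) (h : ∀ a, Θ (fX a) = fY a)
    (hX : @Algebra.Smooth A _ X _ fX.toAlgebra) : @Algebra.Smooth A _ Y _ fY.toAlgebra := by
  letI := fX.toAlgebra
  letI := fY.toAlgebra
  haveI := hX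
  exact Algebra.Smooth.of_equiv (AlgEquiv.ofRingEquiv (f := Θ) h)

/-! ## Transport of a separable regular local model along an isomorphism of the ambient field -/

/-- **The ring form of the third disjunct of `SepExcAt` is invariant under `R`-algebra
isomorphisms of the ambient field.** If `R[s'] ⊆ K'` carries a prime `𝔮'` over `𝔪_R` with
`R[s']_{𝔮'}` regular and `(R[s']/𝔮')[1/g']` smooth over `κ(R)`, and `e : K' ≃ₐ[R] K`, then
`R[e(s')] ⊆ K` carries the pushed-forward data: `e` restricts to an `R`-algebra isomorphism
`R[s'] ≃ R[e(s')]`, which induces isomorphisms of the local rings, of the quotients and of their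
localisations, compatibly with the `κ(R)`-structures. [folklore] -/
theorem model_of_algEquiv {R K K' : Type*} [CommRing R] [IsLocalRing R] [Field K] [Field K']
    [Algebra R K] [Algebra R K'] (e : K' ≃ₐ[R] K) (s' : Finset K')
    (𝔮' : Ideal (Algebra.adjoin R (s' : Set K'))) [𝔮'.IsPrime]
    (hle' : maximalIdeal R ≤ 𝔮'.comap (algebraMap R (Algebra.adjoin R (s' : Set K'))))
    (hreg' : IsRegularLocalRing (Localization.AtPrime 𝔮'))
    (g' : Algebra.adjoin R (s' : Set K')) (hg' : g' ∉ 𝔮')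
    (hsm' : @Algebra.Smooth (R ⧸ maximalIdeal R) _ (Localization.Away (Ideal.Quotient.mk 𝔮' g')) _
      ((algebraMap _ (Localization.Away (Ideal.Quotient.mk 𝔮' g'))).comp
        (Ideal.quotientMap 𝔮' (algebraMap R (Algebra.adjoin R (s' : Set K'))) hle')).toAlgebra) :
    ∃ (s : Finset K) (𝔮 : Ideal (Algebra.adjoin R (s : Set K))) (_ : 𝔮.IsPrime)
      (hle : maximalIdeal R ≤ 𝔮.comap (algebraMap R (Algebra.adjoin R (s : Set K)))),
      IsRegularLocalRing (Localization.AtPrime 𝔮) ∧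
        ∃ g : Algebra.adjoin R (s : Set K), g ∉ 𝔮 ∧
          @Algebra.Smooth (R ⧸ maximalIdeal R) _ (Localization.Away (Ideal.Quotient.mk 𝔮 g)) _
            ((algebraMap _ (Localization.Away (Ideal.Quotient.mk 𝔮 g))).comp
              (Ideal.quotientMap 𝔮 (algebraMap R (Algebra.adjoin R (s : Set K))) hle)).toAlgebra := by
  classical
  -- `φ : R[s'] ≃ₐ[R] R[e(s')]`, the restriction of `e`
  have hmap : (Algebra.adjoin R (s' : Set K')).map (e : K' →ₐ[R] K) =
      Algebra.adjoin R ((s'.image e : Finset K) : Set K) := by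
    rw [AlgHom.map_adjoin, Finset.coe_image]
    rfl
  let φ : Algebra.adjoin R (s' : Set K') ≃ₐ[R] Algebra.adjoin R ((s'.image e : Finset K) : Set K) :=
    (e.subalgebraMap _).trans (Subalgebra.equivOfEq _ _ hmap)
  let ε : Algebra.adjoin R ((s'.image e : Finset K) : Set K) ≃+* Algebra.adjoin R (s' : Set K') :=
    φ.toRingEquiv.symm
  have hεR : ∀ r : R, ε (algebraMap R _ r) = algebraMap R _ r := fun r => φ.symm.commutes r
  have hεφ : ∀ x, ε (φ x) = x := fun x => φ.symm_apply_apply x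
  -- the prime `𝔮 = φ(𝔮') = ε⁻¹(𝔮')`
  let 𝔮 : Ideal (Algebra.adjoin R ((s'.image e : Finset K) : Set K)) := 𝔮'.comap ε
  haveI h𝔮 : 𝔮.IsPrime := Ideal.comap_isPrime ε 𝔮'
  have hmem : ∀ x, x ∈ 𝔮 ↔ ε x ∈ 𝔮' := fun x => Iff.rfl
  have hle : maximalIdeal R ≤ 𝔮.comap (algebraMap R _) := fun r hr => by
    rw [Ideal.mem_comap, hmem, hεR]
    exact hle' hr
  -- `B_𝔮 ≅ B'_{𝔮'}` is regular
  let eLoc : Localization.AtPrime 𝔮 ≃+* Localization.AtPrime 𝔮' :=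
    IsLocalization.ringEquivOfRingEquiv (Localization.AtPrime (𝔮'.comap ε))
      (Localization.AtPrime 𝔮') ε (ε.map_primeCompl_comap_eq 𝔮')
  have hreg : IsRegularLocalRing (Localization.AtPrime 𝔮) := by
    haveI := hreg'
    exact IsRegularLocalRing.of_ringEquiv eLoc.symm
  refine ⟨s'.image e, 𝔮, h𝔮, hle, hreg, φ g', fun h => hg' (by rwa [hmem, hεφ] at h), ?_⟩
  -- `(B/𝔮)[1/g] ≅ (B'/𝔮')[1/g']` over `κ(R)`
  have h𝔮map : 𝔮 = 𝔮'.map (φ.toRingEquiv : Algebra.adjoin R (s' : Set K') →+* _) :=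
    (Ideal.map_comap_of_equiv φ.toRingEquiv).symm
  let θ : (Algebra.adjoin R (s' : Set K') ⧸ 𝔮') ≃+* (_ ⧸ 𝔮) :=
    Ideal.quotientEquiv 𝔮' 𝔮 φ.toRingEquiv h𝔮map
  have hθ : ∀ x, θ (Ideal.Quotient.mk 𝔮' x) = Ideal.Quotient.mk 𝔮 (φ x) := fun x => rfl
  have Hpow : (Submonoid.powers (Ideal.Quotient.mk 𝔮' g')).map θ.toMonoidHom =
      Submonoid.powers (Ideal.Quotient.mk 𝔮 (φ g')) := by
    rw [Submonoid.map_powers]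
    rfl
  let Θ : Localization.Away (Ideal.Quotient.mk 𝔮' g') ≃+*
      Localization.Away (Ideal.Quotient.mk 𝔮 (φ g')) :=
    IsLocalization.ringEquivOfRingEquiv (Localization.Away (Ideal.Quotient.mk 𝔮' g'))
      (Localization.Away (Ideal.Quotient.mk 𝔮 (φ g'))) θ Hpow
  have hΘ : ∀ x, Θ (algebraMap _ (Localization.Away (Ideal.Quotient.mk 𝔮' g')) x) =
      algebraMap _ (Localization.Away (Ideal.Quotient.mk 𝔮 (φ g'))) (θ x) := fun x =>
    IsLocalization.ringEquivOfRingEquiv_eq Hpow x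
  -- compatibility with the `κ(R)`-structures, checked on `r ∈ R`
  refine smooth_of_ringEquiv_comp _ _ Θ (fun x => ?_) hsm'
  obtain ⟨r, rfl⟩ := Ideal.Quotient.mk_surjective x
  have e1 : Ideal.quotientMap 𝔮' (algebraMap R (Algebra.adjoin R (s' : Set K'))) hle'
      (Ideal.Quotient.mk _ r) = Ideal.Quotient.mk 𝔮' (algebraMap R _ r) := Ideal.quotientMap_mk
  have e2 : Ideal.quotientMap 𝔮 (algebraMap R (Algebra.adjoin R ((s'.image e : Finset K) : Set K)))
      hle (Ideal.Quotient.mk _ r) = Ideal.Quotient.mk 𝔮 (algebraMap R _ r) := Ideal.quotientMap_mk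
  calc Θ (((algebraMap _ (Localization.Away (Ideal.Quotient.mk 𝔮' g'))).comp
          (Ideal.quotientMap 𝔮' (algebraMap R (Algebra.adjoin R (s' : Set K'))) hle'))
          (Ideal.Quotient.mk _ r))
      = Θ (algebraMap _ (Localization.Away (Ideal.Quotient.mk 𝔮' g'))
          (Ideal.quotientMap 𝔮' (algebraMap R (Algebra.adjoin R (s' : Set K'))) hle'
            (Ideal.Quotient.mk _ r))) := rfl
    _ = Θ (algebraMap _ (Localization.Away (Ideal.Quotient.mk 𝔮' g'))
          (Ideal.Quotient.mk 𝔮' (algebraMap R _ r))) :=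
        (congrArg (fun y : _ ⧸ 𝔮' =>
          Θ (algebraMap _ (Localization.Away (Ideal.Quotient.mk 𝔮' g')) y)) e1 :)
    _ = algebraMap _ (Localization.Away (Ideal.Quotient.mk 𝔮 (φ g')))
          (θ (Ideal.Quotient.mk 𝔮' (algebraMap R _ r))) := (hΘ _ :)
    _ = algebraMap _ (Localization.Away (Ideal.Quotient.mk 𝔮 (φ g')))
          (Ideal.Quotient.mk 𝔮 (φ (algebraMap R _ r))) :=
        (congrArg (algebraMap _ (Localization.Away (Ideal.Quotient.mk 𝔮 (φ g')))) (hθ _) :)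
    _ = algebraMap _ (Localization.Away (Ideal.Quotient.mk 𝔮 (φ g')))
          (Ideal.Quotient.mk 𝔮 (algebraMap R _ r)) :=
        (congrArg (fun y => algebraMap _ (Localization.Away (Ideal.Quotient.mk 𝔮 (φ g')))
          (Ideal.Quotient.mk 𝔮 y)) (φ.commutes r) :)
    _ = algebraMap _ (Localization.Away (Ideal.Quotient.mk 𝔮 (φ g')))
          (Ideal.quotientMap 𝔮 (algebraMap R _) hle (Ideal.Quotient.mk _ r)) :=
        (congrArg (algebraMap _ (Localization.Away (Ideal.Quotient.mk 𝔮 (φ g')))) e2.symm :)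
    _ = ((algebraMap _ (Localization.Away (Ideal.Quotient.mk 𝔮 (φ g')))).comp
          (Ideal.quotientMap 𝔮 (algebraMap R _) hle)) (Ideal.Quotient.mk _ r) := rfl

/-! ## A regular local ring is its own separable regular local model -/

/-- **A regular local ring `R ⊆ K` carries the trivial separable regular local model**:
`s = ∅`, `B = R[∅] = R` (the structure map `R → K` being injective), `𝔮 = 𝔪_R`, `B_𝔮 ≅ R`
(a local ring is its own localisation at the maximal ideal), `g = 1` and
`(B/𝔮)[1/1] ≅ κ(R)`, smooth over `κ(R)`. [folklore] -/
theorem model_of_isRegularLocalRing {R K : Type} [CommRing R] [IsLocalRing R] [Field K]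
    [Algebra R K] (hinj : Function.Injective (algebraMap R K)) (hreg : IsRegularLocalRing R) :
    ∃ (s : Finset K) (𝔮 : Ideal (Algebra.adjoin R (s : Set K))) (_ : 𝔮.IsPrime)
      (hle : IsLocalRing.maximalIdeal R ≤
        𝔮.comap (algebraMap R (Algebra.adjoin R (s : Set K)))),
      IsRegularLocalRing (Localization.AtPrime 𝔮) ∧
        ∃ g : Algebra.adjoin R (s : Set K), g ∉ 𝔮 ∧
          @Algebra.Smooth (R ⧸ IsLocalRing.maximalIdeal R) _
            (Localization.Away (Ideal.Quotient.mk 𝔮 g)) _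
            ((algebraMap _ (Localization.Away (Ideal.Quotient.mk 𝔮 g))).comp
              (Ideal.quotientMap 𝔮 (algebraMap R (Algebra.adjoin R (s : Set K))) hle)).toAlgebra := by
  classical
  let B : Subalgebra R K := Algebra.adjoin R ((∅ : Finset K) : Set K)
  -- `R → B` is bijective
  have hBinj : Function.Injective (algebraMap R B) := fun x y hxy => hinj (by
    have h := congrArg (fun b : B => (b : K)) hxy
    rwa [Subalgebra.coe_algebraMap, Subalgebra.coe_algebraMap] at h)
  have hBsurj : Function.Surjective (algebraMap R B) := by
    rintro ⟨b, hb⟩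
    have hb' : b ∈ (⊥ : Subalgebra R K) := by
      have hb₀ : b ∈ Algebra.adjoin R ((∅ : Finset K) : Set K) := hb
      rwa [Finset.coe_empty, Algebra.adjoin_empty] at hb₀
    obtain ⟨r, hr⟩ := Algebra.mem_bot.mp hb'
    exact ⟨r, Subtype.ext hr⟩
  let eB : R ≃+* B := RingEquiv.ofBijective (algebraMap R B) ⟨hBinj, hBsurj⟩
  -- `𝔮 = 𝔪_R B`
  let 𝔮 : Ideal B := (maximalIdeal R).comap eB.symm
  haveI h𝔮 : 𝔮.IsPrime := Ideal.comap_isPrime eB.symm _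
  have hmem : ∀ r : R, algebraMap R B r ∈ 𝔮 ↔ r ∈ maximalIdeal R := fun r => by
    change eB.symm (eB r) ∈ maximalIdeal R ↔ _
    rw [eB.symm_apply_apply]
  have hle : maximalIdeal R ≤ 𝔮.comap (algebraMap R B) := fun r hr => (hmem r).mpr hr
  -- `B_𝔮 ≅ R_{𝔪_R} ≅ R` is regular
  let e₁ : Localization.AtPrime 𝔮 ≃+* Localization.AtPrime (maximalIdeal R) :=
    IsLocalization.ringEquivOfRingEquiv (Localization.AtPrime ((maximalIdeal R).comap eB.symm))
      (Localization.AtPrime (maximalIdeal R)) eB.symm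
      (eB.symm.map_primeCompl_comap_eq (maximalIdeal R))
  let e₂ : R ≃ₐ[R] Localization.AtPrime (maximalIdeal R) :=
    IsLocalization.atUnits R (maximalIdeal R).primeCompl fun x hx =>
      IsLocalRing.notMem_maximalIdeal.mp hx
  have hreg𝔮 : IsRegularLocalRing (Localization.AtPrime 𝔮) := by
    haveI := hreg
    exact IsRegularLocalRing.of_ringEquiv (e₂.toRingEquiv.trans e₁.symm)
  -- `κ(R) ≅ B/𝔮 ≅ (B/𝔮)[1/1]`
  have h1 : (1 : B) ∉ 𝔮 := (Ideal.ne_top_iff_one 𝔮).mp h𝔮.ne_top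
  have hinjq : Function.Injective (Ideal.quotientMap 𝔮 (algebraMap R B) hle) :=
    Ideal.quotientMap_injective' fun r hr => (hmem r).mp hr
  have hsurjq : Function.Surjective (Ideal.quotientMap 𝔮 (algebraMap R B) hle) := by
    intro y
    obtain ⟨b, rfl⟩ := Ideal.Quotient.mk_surjective y
    obtain ⟨r, rfl⟩ := hBsurj b
    exact ⟨Ideal.Quotient.mk _ r, by rw [Ideal.quotientMap_mk]⟩
  letI instκ : Algebra (R ⧸ maximalIdeal R) (Localization.Away (Ideal.Quotient.mk 𝔮 (1 : B))) :=
    ((algebraMap _ (Localization.Away (Ideal.Quotient.mk 𝔮 (1 : B)))).comp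
      (Ideal.quotientMap 𝔮 (algebraMap R B) hle)).toAlgebra
  have hbij : Function.Bijective
      (algebraMap (R ⧸ maximalIdeal R) (Localization.Away (Ideal.Quotient.mk 𝔮 (1 : B)))) :=
    (bijective_algebraMap_of_away_isUnit (T := Localization.Away (Ideal.Quotient.mk 𝔮 (1 : B)))
      (Ideal.Quotient.mk 𝔮 (1 : B)) (isUnit_one.map _)).comp ⟨hinjq, hsurjq⟩
  exact ⟨∅, 𝔮, h𝔮, hle, hreg𝔮, 1, h1, smooth_of_bijective_algebraMap hbij⟩

/-! ## The function field isomorphism of a birational morphism -/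

/-- **A birational morphism of integral schemes identifies the function fields, compatibly
with all stalk maps.** For `π : Y' → Y` birational between integral schemes there is a ring
isomorphism `e : K(Y) ≃ K(Y')` with `e(s_η) = (π♯_y s)_{η'}` for every `y ∈ Y'` and every germ
`s ∈ 𝒪_{Y,π y}`: `π` is dominant, so `π(η') = η`, the stalk map at `η'` is an isomorphism
(`IsBirational.isIso_stalkMap_genericPoint`), and stalk maps commute with specialisation
maps. [cite: StacksProject, Tag 01RN] -/
theorem exists_ringEquiv_functionField_of_isBirational {Y' Y : Scheme.{u}} [IsIntegral Y']
    [IsIntegral Y] {π : Y' ⟶ Y} (hπ : IsBirational π) :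
    ∃ e : Y.functionField ≃+* Y'.functionField, ∀ (y : Y') (s : Y.presheaf.stalk (π.base y)),
      e (algebraMap _ Y.functionField s) =
        algebraMap _ Y'.functionField ((π.stalkMap y).hom s) := by
  haveI : IsDominant π := hπ.isDominant
  have hgen : π.base (genericPoint Y') = genericPoint Y := genericPoint_eq_of_isDominant π
  haveI := hπ.isIso_stalkMap_genericPoint
  haveI hι : IsIso ((Y.presheaf.stalkCongr (.of_eq hgen)).inv ≫ π.stalkMap (genericPoint Y')) :=
    inferInstance
  refine ⟨(asIso ((Y.presheaf.stalkCongr (.of_eq hgen)).inv ≫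
    π.stalkMap (genericPoint Y'))).commRingCatIsoToRingEquiv, fun y s => ?_⟩
  have hsv : genericPoint Y' ⤳ y := genericPoint_specializes y
  have key : Y.presheaf.stalkSpecializes (genericPoint_specializes (π.base y)) ≫
      (Y.presheaf.stalkCongr (.of_eq hgen)).inv ≫ π.stalkMap (genericPoint Y') =
      π.stalkMap y ≫ Y'.presheaf.stalkSpecializes hsv := by
    rw [← Scheme.Hom.stalkSpecializes_stalkMap π _ y hsv, ← Category.assoc]
    congr 1
    simp [TopCat.Presheaf.stalkCongr]
  have := DFunLike.congr_fun (CommRingCat.hom_ext_iff.mp key) s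
  change (π.stalkMap (genericPoint Y')).hom ((Y.presheaf.stalkCongr (.of_eq hgen)).inv.hom
      ((Y.presheaf.stalkSpecializes (genericPoint_specializes (π.base y))).hom s)) =
    (Y'.presheaf.stalkSpecializes hsv).hom ((π.stalkMap y).hom s)
  simpa using this

end Summit.ResolutionOfSingularities.ResolutionOfSingularities.Theorems.SepExcModels.SepExcDescends

end
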